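import Summits.BirchSwinnertonDyer.BirchSwinnertonDyer.Theses.ByReductionTypeAtTwo
import Summits.BirchSwinnertonDyer.Rank1Residual.F1Sign2.DescentSignAtTwo
import Literature.NumberTheory.EllipticCurves.PAdicHeights
import Literature.NumberTheory.EllipticCurves.BSDRootNumberSmallConductorProofs
import HarnessLib

/-!
# ES-28 (cell bsd-f1-sign2, seat -es g19): THE LEVEL-RAISING (BIPARTITE) EULER SYSTEM AT `p = 2`, OVER `ℚ`

Sketch only (planner seat; nothing here is proposed to the tree; the typer ports).  Crux `RankOneAtTwoBigImageOddLocal`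
(stmt-BirchSwinnertonDyer-23715), LINE v8.17 `one_door_analytic`, stub `stub_heegnerExponent` (R₀⁺ = Kolyvagin's conjecture at `2` at a
`Sel₂`-trivial minimal door).  W. Zhang's proof of Kolyvagin's conjecture for odd `p` (Camb. J. Math. 2014) runs: level raising at an
admissible prime `q` ⟶ rank lowering `Sel(A/K) = 0` ⟶ rank-`0` converse (`L(A/K,1)` a `p`-unit) ⟶ Jochnowitz / Bertolini–Darmon first
reciprocity law (`loc_q κ(y_K) ≠ 0`).  At `p = 2` the first step is in print (Le Hung–Li, Compositio 2016, arXiv:1501.01344: Thm 15 level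
raising mod `2` with prescribed signs; Lemma 45 local conditions; Lemma 47 / Lemma 58 rank lowering / raising; all under `Δ < 0`), the
second FAILS over `K` (the localisation of a `ℚ`-rational class at a prime inert in `K` lies in the `Frob_q`-invariant line, which is
inside the level-raised local condition: `dim Sel₂(A/K) ≥ 2` always — C. Li's "obstruction to rank lowering"), and nothing is in print for
the last two.  THIS SKETCH MOVES THE WHOLE LADDER TO `ℚ`: at a TRANSPOSITION prime `q` (`(Δ_W/q) = −1`) and a level-raised ELLIPTIC CURVE
`W'` of conductor `N_W q`, SPLIT multiplicative at `q`, the Kummer bit `b_q(P) = [P ∈ 2E(ℚ_q)]` of a generator decides `Sel₂(W')`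
exactly (`LevelRaisedSelmerLawAtTwo`, theorem-grade: LHL Lemma 45/47 + Dokchitser–Dokchitser `2`-parity + root numbers; the real place
enters through `SameRealKummerLine` when `Δ_W > 0`, which is OUTSIDE LHL's standing assumption `Δ < 0`), and the first explicit reciprocity
law at `2` becomes the VALUE statement `LevelRaisedFirstReciprocityAtTwo` (`#Ш_an(W')` odd ⟺ `b_q(P) = 0`; conjecture; census ENGINE LR28).
The over-`K` Jochnowitz congruence is recovered as the product of the split member `W'` and its NON-split twist `W'^{(d_K)}`
(`LevelRaisedNonsplitInertAtTwo`), whose forced factors (`c_q` even, `Ш(A/K)[2] ⊇ 𝔽₂²`) are exactly Li's obstruction.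
-/

noncomputable section

open scoped Classical

set_option linter.dupNamespace false
set_option autoImplicit false

namespace Summit.BirchSwinnertonDyer.BirchSwinnertonDyer.Theorems.RankOneAtTwoLevelRaising

open Literature.NumberTheory.EllipticCurves Summit.BirchSwinnertonDyer.Rank1Residual.F1Sign2 WeierstrassCurve

/-- The monic-free `2`-division cubic `4x³ + b₂x² + 2b₄x + b₆` of `W` as a polynomial (Mathlib `twoTorsionPolynomial`). -/
abbrev twoDivCubic (W : WeierstrassCurve ℚ) : Polynomial ℚ := W.twoTorsionPolynomial.toPoly

/-- **`W ≡ W' (mod 2)`**: the `2`-division cubic stem algebras `ℚ[x]/(f_W)` and `ℚ[x]/(f_{W'})` are isomorphic `ℚ`-algebras.  When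
`ρ̄_{W,2}` is onto `GL₂(𝔽₂) ≅ S₃` (`f_W` irreducible with non-Galois stem field) this says exactly `W[2] ≅ W'[2]` as Galois modules, and the
isomorphism of stem fields — hence of `2`-torsion modules — is UNIQUE. -/
def ModTwoCongruent (W W' : WeierstrassCurve ℚ) : Prop :=
  Nonempty (AdjoinRoot (twoDivCubic W) ≃ₐ[ℚ] AdjoinRoot (twoDivCubic W'))

/-- `x : ℝ` is the SMALLEST real root of `f`. -/
def IsMinRealRoot (f : Polynomial ℚ) (x : ℝ) : Prop :=
  Polynomial.aeval x f = 0 ∧ ∀ y : ℝ, Polynomial.aeval y f = 0 → x ≤ y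

/-- **Same real Kummer line** (`Δ_W, Δ_{W'} > 0`): under the (unique) congruence `W[2] ≅ W'[2]` the `2`-torsion point of `W` with the
SMALLEST abscissa corresponds to that of `W'`.  Since `E(ℝ)/2E(ℝ) → H¹(ℝ, E[2]) ≅ E[2]` has image the line spanned by the smallest-root
point (`℘(ω₂/2) = e₃`), this is `L_∞(W) = L_∞(W')` inside `H¹(ℝ, V)`: the archimedean analogue of "same sign at a level-raising prime". -/
def SameRealKummerLine (W W' : WeierstrassCurve ℚ) : Prop :=
  ∃ σ : AdjoinRoot (twoDivCubic W) ≃ₐ[ℚ] AdjoinRoot (twoDivCubic W'),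
    ∀ ι : AdjoinRoot (twoDivCubic W') →ₐ[ℚ] ℝ,
      IsMinRealRoot (twoDivCubic W) (ι (σ (AdjoinRoot.root (twoDivCubic W)))) ↔
        IsMinRealRoot (twoDivCubic W') (ι (AdjoinRoot.root (twoDivCubic W')))

/-- **The Kummer bit at `q`**: `P ∈ 2·E(ℚ_q)` (`⇔ loc_q κ(P) = 0 ∈ H¹(ℚ_q, E[2])`; at a transposition prime of good reduction
`⇔ P̃ ∈ 2Ẽ(𝔽_q)`, `⇔ (#Ẽ(𝔽_q)/2)·P̃ = O` when `Ẽ(𝔽_q)[2] ≅ ℤ/2` — PARI one-liner). -/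
def LocallyHalvable (W : WeierstrassCurve ℚ) (q : ℕ) [Fact q.Prime] (P : (W.baseChange ℚ).toAffine.Point) : Prop :=
  ∃ Q : (W.baseChange ℚ_[q]).toAffine.Point, 2 • Q = Affine.Point.baseChange (W' := W) ℚ ℚ_[q] P

/-- `P ∉ 2·E(ℚ)` (with `E(ℚ) ≅ ℤ ⊕ (odd)` this says `κ(P) = κ(generator) ≠ 0` in `Sel₂`). -/
def NotTwiceRat (W : WeierstrassCurve ℚ) (P : (W.baseChange ℚ).toAffine.Point) : Prop :=
  ¬ ∃ Q : (W.baseChange ℚ).toAffine.Point, 2 • Q = P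

/-- `ρ̄_{W,2}|_{G_{ℚ₂}}` is non-trivial: the `2`-division cubic does not split completely over `ℚ₂` (Le Hung–Li, Assumption 7 (4);
`⇔ ¬(W ordinary at 2 ∧ Δ_W ∈ (ℚ₂ˣ)²)`). -/
def NontrivialAtTwo (W : WeierstrassCurve ℚ) : Prop :=
  ((twoDivCubic W).map (algebraMap ℚ ℚ_[2])).roots.card < 3

/-- **THE LEVEL-RAISING FRAME at a transposition prime.** `W` of the slice (globally minimal, non-CM, `ρ_{W,2^n}` onto for all `n`,
odd torsion, odd Tamagawa product — hence Serre conductor of `W[2]` = odd part of `N_W`, LHL Assumption 7 (3)), `4 ∤ N_W`, `ρ̄|_{G_{ℚ₂}}`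
non-trivial; `q ∤ 2N_W` prime with `(Δ_W / q) = −1` (Frobenius a TRANSPOSITION on `W[2]`, `H¹(ℚ_q, W[2]) ≅ 𝔽₂²`); `W'` globally minimal of
conductor `N_W·q`, congruent to `W` mod `2`, SPLIT multiplicative at `q` (sign `ε_q = +1`, `L_q(W') = im H¹(ℚ_q, μ₂) ≠ H¹_ur = L_q(W)`). -/
structure LevelRaisedAt (W W' : WeierstrassCurve ℚ) [W.IsGloballyMinimal] [W'.IsGloballyMinimal] (q : ℕ) [Fact q.Prime] : Prop where
  odd_q : q ≠ 2
  good : ¬ (q : ℤ) ∣ (W.conductorNorm ℤ : ℤ)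
  transposition : jacobiSym W.Δ.num q = -1
  level : W'.conductorNorm ℤ = q * W.conductorNorm ℤ
  congruent : ModTwoCongruent W W'
  split : W'.HasSplitMultiplicativeReductionAtPrime q

/-- **ES-28A `LevelRaisedSelmerLawAtTwo` — RANK LOWERING / RAISING OVER `ℚ` AT A TRANSPOSITION PRIME, `p = 2` (THEOREM-candidate:
Le Hung–Li 2016 Lemma 45 + Lemma 47(2) + Dokchitser–Dokchitser `2`-parity + root numbers; the clause `SameRealKummerLine` for `Δ > 0` is
this seat's supplement to LHL's standing assumption `Δ < 0`).**  `W` of the slice with `r_an = 1`, `Ш(W)[2] = 0` (so `Sel₂(W) = ⟨κ(P)⟩`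
for any `P ∉ 2E(ℚ)`), `4 ∤ N_W`, `ρ̄|_{G_{ℚ₂}}` non-trivial, `W'` level-raised from `W` at the transposition prime `q` with sign `+1`, and
either `Δ_W < 0` or the real Kummer lines agree.  THEN, with `r' := r_an(W')` (whose parity is the root number, i.e. the number of
Atkin–Lehner/local-root-number flips at `p ∣ N_W`):
* `P ∉ 2E(ℚ_q)` ⟹ `Sel₂(W') = 0` AND `r'` is even (the Kummer bit FORCES an even number of sign flips at `p ∣ N`);
* `P ∈ 2E(ℚ_q)` ⟹ `#Sel₂(W') = 4` if `r'` is even, `= 2` if `r'` is odd.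
Why it might fail: only through a mis-typed local condition (at `2` when `W'` and `W` have different Kodaira type — excluded by `4 ∤ N` and
LHL Lemma 45 (4)(5); at `∞` for `Δ > 0` — the `SameRealKummerLine` clause).  Census ENGINE LR28 (kit, this seat): P28.1.
[cite: LeHungLi2016, Lemma 45, Lemma 47, Cor. 48, Lemma 58] [cite: DokchitserDokchitserAnnals2010, Thm. 1.4] [cite: Kramer1981, Prop. 3] -/
def LevelRaisedSelmerLawAtTwo : Prop :=
  ∀ (W W' : WeierstrassCurve ℚ) [W.IsElliptic] [W.IsGloballyMinimal] [W'.IsElliptic] [W'.IsGloballyMinimal]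
    (q : ℕ) [Fact q.Prime],
    ¬ W.HasCM → (∀ n : ℕ, W.HasSurjectiveModNGaloisRep ((2 ^ n : ℕ) : ℤ)) → Odd W.torsionOrder → Odd W.tamagawaProduct →
    W.analyticRank = 1 → ShaTwoTrivial W → ¬ (4 : ℕ) ∣ W.conductorNorm ℤ → NontrivialAtTwo W →
    LevelRaisedAt W W' q → (W.Δ < 0 ∨ SameRealKummerLine W W') →
    ∀ P : (W.baseChange ℚ).toAffine.Point, NotTwiceRat W P →
      (¬ LocallyHalvable W q P → selmerTwoCard W' = 1 ∧ Even W'.analyticRank) ∧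
      (LocallyHalvable W q P → (Even W'.analyticRank → selmerTwoCard W' = 4) ∧ (Odd W'.analyticRank → selmerTwoCard W' = 2))

/-- **ES-28B `LevelRaisedRealPlaceLawAtTwo` — LEVEL RAISING AT THE REAL PLACE (THEOREM-candidate, beyond LHL's `Δ < 0`).**  Same frame with
`Δ_W > 0`, `E(ℚ)` meeting the egg (`loc_∞ κ(P) ≠ 0`) and the real Kummer lines of `W`, `W'` DIFFERENT.  THEN `loc_∞` already lowers the
rank (`H¹` with `W`'s conditions away from `∞` and `W'`'s at `∞` vanishes), so `Sel₂(W')` is decided by parity alone, independently of the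
Kummer bit at `q`: `#Sel₂(W') = 1` if `r_an(W')` is even, `= 2` if odd.  Why it might fail: the identification `L_∞ = ⟨(e_min, 0)⟩` and the
uniqueness of the stem-field isomorphism are the only inputs beyond LHL Lemma 47.  Census ENGINE LR28: P28.2.
[cite: LeHungLi2016, Lemma 47] [cite: Kramer1981, Prop. 3] [cite: DokchitserDokchitserAnnals2010, Thm. 1.4] -/
def LevelRaisedRealPlaceLawAtTwo : Prop :=
  ∀ (W W' : WeierstrassCurve ℚ) [W.IsElliptic] [W.IsGloballyMinimal] [W'.IsElliptic] [W'.IsGloballyMinimal]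
    (q : ℕ) [Fact q.Prime],
    ¬ W.HasCM → (∀ n : ℕ, W.HasSurjectiveModNGaloisRep ((2 ^ n : ℕ) : ℤ)) → Odd W.torsionOrder → Odd W.tamagawaProduct →
    W.analyticRank = 1 → ShaTwoTrivial W → ¬ (4 : ℕ) ∣ W.conductorNorm ℤ → NontrivialAtTwo W →
    LevelRaisedAt W W' q → 0 < W.Δ → MeetsEgg W → ¬ SameRealKummerLine W W' →
      (Even W'.analyticRank → selmerTwoCard W' = 1) ∧ (Odd W'.analyticRank → selmerTwoCard W' = 2)

/-- **ES-28C `LevelRaisedFirstReciprocityAtTwo` — THE FIRST EXPLICIT RECIPROCITY LAW OF THE LEVEL-RAISING EULER SYSTEM AT `p = 2`, OVER `ℚ`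
(CONJECTURE of this lens; = Bertolini–Darmon's first reciprocity / the Jochnowitz congruence at `2` in the split normalisation; implied by
`BSD₂(W')` given ES-28A, and conversely giving the `2`-adic valuation clause of `BSD₂(W')` on the `Sel₂(W') = 0` rows).**  Same frame as ES-28A
with `r_an(W') = 0`.  THEN `#Ш_an(W')` (`shaAn W' = L(W',1)·#W'(ℚ)_tors² / (Ω_{W'} ∏_p c_p(W'))`) is an ODD INTEGER iff `P ∉ 2E(ℚ_q)`:
the `2`-adic unit-ness of the level-raised central value is read off the Kummer bit of the generator at `q` (note `c_q(W') = v_q(Δ_{W'})`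
is always EVEN here, `W'[2]` being unramified at `q`).  Why it might fail: it is rank-`0` `BSD₂`-exactness for the level-raised family
(no Kato divisibility at `p = 2`, no Skinner–Urban at `2`); a single row with `Sel₂(W') = 0` and `#Ш_an(W')` even, or `#Sel₂(W') = 4`,
`r_an = 0` and `#Ш_an(W')` odd, refutes it.  Census ENGINE LR28: P28.3.
[cite: BertoliniDarmon2005, Thm. 4.1 (first reciprocity law, p odd)] [cite: ZhangCJM2014, Thm. 1.1 and §5 (p odd)] [cite: LeHungLi2016, §1] -/
@[conjecture] def LevelRaisedFirstReciprocityAtTwo : Prop :=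
  ∀ (W W' : WeierstrassCurve ℚ) [W.IsElliptic] [W.IsGloballyMinimal] [W'.IsElliptic] [W'.IsGloballyMinimal]
    (q : ℕ) [Fact q.Prime],
    ¬ W.HasCM → (∀ n : ℕ, W.HasSurjectiveModNGaloisRep ((2 ^ n : ℕ) : ℤ)) → Odd W.torsionOrder → Odd W.tamagawaProduct →
    W.analyticRank = 1 → ShaTwoTrivial W → ¬ (4 : ℕ) ∣ W.conductorNorm ℤ → NontrivialAtTwo W →
    LevelRaisedAt W W' q → (W.Δ < 0 ∨ SameRealKummerLine W W') → W'.analyticRank = 0 →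
    ∀ P : (W.baseChange ℚ).toAffine.Point, NotTwiceRat W P →
      ((∃ n : ℕ, Odd n ∧ shaAn W' = (n : ℂ)) ↔ ¬ LocallyHalvable W q P)

/-- **ES-28D `LevelRaisedNonsplitInertAtTwo` — THE NON-SPLIT MEMBER IS SELMER-INERT (THEOREM-candidate / to be settled by the census:
the component group of the non-split level-raised curve at `q` has order `2`, so Gross–Parson's criterion is at its boundary).**  Same frame
but `W'` NON-split multiplicative at `q` (`ε_q = −1`; this is the `χ_{d_K}`-twist of the split member when `q` is inert in `K`).  THEN
`#Sel₂(W') = #Sel₂(W) = 2` whenever `r_an(W')` is odd.  Why it might fail: if the Kummer image at a non-split prime with `c_q = 2` is the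
ramified line rather than `H¹_ur`, the law flips to the ES-28A shape; ENGINE LR28 P28.4 decides which.
[cite: LeHungLi2016, Lemma 45 (5) (the analogous statement at 2)] [cite: GrossParson2012, Prop. 4.1 (shape)] -/
def LevelRaisedNonsplitInertAtTwo : Prop :=
  ∀ (W W' : WeierstrassCurve ℚ) [W.IsElliptic] [W.IsGloballyMinimal] [W'.IsElliptic] [W'.IsGloballyMinimal]
    (q : ℕ) [Fact q.Prime],
    ¬ W.HasCM → (∀ n : ℕ, W.HasSurjectiveModNGaloisRep ((2 ^ n : ℕ) : ℤ)) → Odd W.torsionOrder → Odd W.tamagawaProduct →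
    W.analyticRank = 1 → ShaTwoTrivial W → ¬ (4 : ℕ) ∣ W.conductorNorm ℤ → NontrivialAtTwo W →
    q ≠ 2 → ¬ (q : ℤ) ∣ (W.conductorNorm ℤ : ℤ) → jacobiSym W.Δ.num q = -1 → W'.conductorNorm ℤ = q * W.conductorNorm ℤ →
    ModTwoCongruent W W' → W'.HasMultiplicativeReductionAtPrime q → ¬ W'.HasSplitMultiplicativeReductionAtPrime q →
    (W.Δ < 0 ∨ SameRealKummerLine W W') → Odd W'.analyticRank → selmerTwoCard W' = 2

/-- `x : ℝ` is the MIDDLE real root of `f` (three real roots). -/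
def IsMidRealRoot (f : Polynomial ℚ) (x : ℝ) : Prop :=
  Polynomial.aeval x f = 0 ∧ (∃ y : ℝ, Polynomial.aeval y f = 0 ∧ y < x) ∧ (∃ z : ℝ, Polynomial.aeval z f = 0 ∧ x < z)

/-- `x : ℝ` is the LARGEST real root of `f`. -/
def IsMaxRealRoot (f : Polynomial ℚ) (x : ℝ) : Prop :=
  Polynomial.aeval x f = 0 ∧ ∀ y : ℝ, Polynomial.aeval y f = 0 → y ≤ x

/-- **`m(W,W')`**: the (unique) congruence `W[2] ≅ W'[2]` sends the `2`-torsion point of `W` with the SMALLEST abscissa to the one of `W'` with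
the MIDDLE abscissa (`Δ_W, Δ_{W'} > 0`).  Equivalently: the product of differents `β(W,W') = f_W'(θ)·f_{W'}'(θ')` — a class in
`ker(N : K₃ˣ/K₃ˣ² → ℚˣ/ℚˣ²) = H¹(ℚ, W[2])`, `K₃` the common cubic `2`-division field — is NEGATIVE at the two real places of `K₃` where an
egg point has negative Kummer coordinates an odd number of times. -/
def SendsMinToMid (W W' : WeierstrassCurve ℚ) : Prop :=
  ∃ σ : AdjoinRoot (twoDivCubic W) ≃ₐ[ℚ] AdjoinRoot (twoDivCubic W'),
    ∀ ι : AdjoinRoot (twoDivCubic W') →ₐ[ℚ] ℝ,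
      IsMinRealRoot (twoDivCubic W) (ι (σ (AdjoinRoot.root (twoDivCubic W)))) →
        IsMidRealRoot (twoDivCubic W') (ι (AdjoinRoot.root (twoDivCubic W')))

/-- **`egg(P)`**: `Δ_W > 0` and the rational point `P` lies on the non-identity real component (`x(P) <` the largest `2`-division
abscissa), i.e. `loc_∞ κ(P) ≠ 0`. -/
def OnEggPt (W : WeierstrassCurve ℚ) (P : (W.baseChange ℚ).toAffine.Point) : Prop :=
  0 < W.Δ ∧ ∃ x y : ℚ, ∃ h : (W.baseChange ℚ).toAffine.Nonsingular x y,
    P = WeierstrassCurve.Affine.Point.some x y h ∧ ∃ e : ℝ, IsMaxRealRoot (twoDivCubic W) e ∧ ((x : ℝ) < e)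

/-- **`t_q(W')`**: `W'[4]` is RAMIFIED at the multiplicative prime `q`, i.e. `v_q(Δ_{W'}) ≡ 2 (mod 4)` (`v_q(Δ_{W'})` is even because `W'[2]` is
unramified at `q`; `W'` globally minimal). -/
def MonodromyBitAtTwo (W' : WeierstrassCurve ℚ) (q : ℕ) : Prop := ¬ (4 : ℤ) ∣ padicValRat q W'.Δ

/-- **ES-28E `LevelRaisedMonodromyReciprocityAtTwo` — THE MOD-4 MONODROMY RECIPROCITY LAW (this seat's candidate «signed object at 2»;
THEOREM-candidate, NOT in print: proof sketch = Hilbert reciprocity in the cubic `2`-division field `K₃` for the pair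
(`β(W,W') = f'_W(θ) f'_{W'}(θ')`, `x(P) − θ`) — `β` is the `W[2]`-component of the difference cocycle of the mod-`4` representations
`ρ_{W,4}`, `ρ_{W',4}`, the symbols at `w ∤ q∞` vanish because `β_w` and `κ(P)_w` lie in the common Lagrangian `L_w(W) = L_w(W')`, the symbol above
`q` is `(1 − b_q(P))·t_q(W')` and the real symbols give `egg(P)·m(W,W')`).**  Frame: `W` of the slice, GOOD at `2`, `ρ̄|_{G_{ℚ₂}}` non-trivial,
`q ∤ 2N_W` a transposition prime, `W'` globally minimal of conductor `N_W q` congruent to `W` mod `2` and multiplicative at `q` (EITHER sign).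
THEN for every `P ∉ 2E(ℚ)`:   `[P ∉ 2E(ℚ_q)] ∧ [v_q(Δ_{W'}) ≡ 2 (mod 4)]   ⟺   [P on the egg] ∧ [smallest root of W ↦ middle root of W']`.
Consequences: `Δ_W < 0` or `P` on the identity component or `b_q(P) = 0` with matching real lines ⟹ `4 ∣ v_q(Δ_{W'})` (P28.6); on the egg with
`m = 1` every congruent `W'` has `b_q(P) = 0` and `v_q(Δ_{W'}) ≡ 2 (mod 4)`.  Frame as in the slice: `4 ∤ N_W` and `ρ̄|_{G_{ℚ₂}} ≠ 1`
(LHL Assumption 7 (1),(4)); `2 ∥ N_W` with DIFFERENT Kodaira types of `W`, `W'` at `2` is allowed (law holds there too: 784/784 pilot rows).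
Why it might fail: only via the `2`-adic Hilbert symbol (it DOES contribute in the two excluded classes) or at an odd `p ∣ N_W` with `Φ_p(W)` even
(excluded by `Odd W.tamagawaProduct`; untested).  Census ENGINE LR28 pilot j328808:
1338/1338 decidable rows with `4 ∤ N_W`, `ρ̄|_{G_{ℚ₂}} ≠ 1` (split 624 / non-split 714; `Δ<0` 453 / `Δ>0` 885; `dim Sel₂(W')` = 0: 437, 1: 795, 2: 106;
270 slice curves, 737 raised curves, `q ≤ 227`), 0 violations — the excluded classes DO violate (`4 ∣ N_W`: 498/984; `ρ̄|_{G_{ℚ₂}} = 1`: 2/6);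
full run (277 269 triples): MEMO-es §28.
[cite: LeHungLi2016, Lemma 44–45 (the three lines at a transposition prime)] [cite: Cassels1998JRAM, §2 (H¹(ℚ,E[2]) ⊂ K₃ˣ/K₃ˣ², local pairing = sum of Hilbert symbols)] [cite: Kramer1981, Prop. 3] -/
def LevelRaisedMonodromyReciprocityAtTwo : Prop :=
  ∀ (W W' : WeierstrassCurve ℚ) [W.IsElliptic] [W.IsGloballyMinimal] [W'.IsElliptic] [W'.IsGloballyMinimal]
    (q : ℕ) [Fact q.Prime],
    ¬ W.HasCM → (∀ n : ℕ, W.HasSurjectiveModNGaloisRep ((2 ^ n : ℕ) : ℤ)) → Odd W.torsionOrder → Odd W.tamagawaProduct →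
    W.analyticRank = 1 → ¬ (4 : ℕ) ∣ W.conductorNorm ℤ → NontrivialAtTwo W →
    q ≠ 2 → ¬ (q : ℤ) ∣ (W.conductorNorm ℤ : ℤ) → jacobiSym W.Δ.num q = -1 → W'.conductorNorm ℤ = q * W.conductorNorm ℤ →
    ModTwoCongruent W W' → W'.HasMultiplicativeReductionAtPrime q →
    ∀ P : (W.baseChange ℚ).toAffine.Point, NotTwiceRat W P →
      ((¬ LocallyHalvable W q P ∧ MonodromyBitAtTwo W' q) ↔ (OnEggPt W P ∧ SendsMinToMid W W'))

/-- The `Δ < 0` shadow of ES-28E, the form the memo quotes as P28.6: `P ∉ 2E(ℚ_q) ⟹ 4 ∣ v_q(Δ_{W'})`. -/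
theorem four_dvd_of_monodromyReciprocity (h : LevelRaisedMonodromyReciprocityAtTwo)
    (W W' : WeierstrassCurve ℚ) [W.IsElliptic] [W.IsGloballyMinimal] [W'.IsElliptic] [W'.IsGloballyMinimal] (q : ℕ) [Fact q.Prime]
    (h1 : ¬ W.HasCM) (h2 : ∀ n : ℕ, W.HasSurjectiveModNGaloisRep ((2 ^ n : ℕ) : ℤ)) (h3 : Odd W.torsionOrder) (h4 : Odd W.tamagawaProduct)
    (h5 : W.analyticRank = 1) (h6 : ¬ (4 : ℕ) ∣ W.conductorNorm ℤ) (h7 : NontrivialAtTwo W)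
    (hq : q ≠ 2) (hgood : ¬ (q : ℤ) ∣ (W.conductorNorm ℤ : ℤ)) (htr : jacobiSym W.Δ.num q = -1) (hlev : W'.conductorNorm ℤ = q * W.conductorNorm ℤ)
    (hc : ModTwoCongruent W W') (hm : W'.HasMultiplicativeReductionAtPrime q) (hneg : W.Δ < 0)
    (P : (W.baseChange ℚ).toAffine.Point) (hP : NotTwiceRat W P) (hb : ¬ LocallyHalvable W q P) :
    (4 : ℤ) ∣ padicValRat q W'.Δ := by
  by_contra ht
  have key := (h W W' q h1 h2 h3 h4 h5 h6 h7 hq hgood htr hlev hc hm P hP).1 ⟨hb, ht⟩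
  exact absurd key.1.1 (not_lt.mpr (le_of_lt hneg))

/-- Elementary glue (the shape of the ℚ-decomposed Jochnowitz congruence): on a row where ES-28A puts `Sel₂(W') = 0`, ES-28C gives an odd
`#Ш_an(W')`. -/
theorem shaAn_odd_of_laws (hA : LevelRaisedSelmerLawAtTwo) (hC : LevelRaisedFirstReciprocityAtTwo)
    (W W' : WeierstrassCurve ℚ) [W.IsElliptic] [W.IsGloballyMinimal] [W'.IsElliptic] [W'.IsGloballyMinimal] (q : ℕ) [Fact q.Prime]
    (h1 : ¬ W.HasCM) (h2 : ∀ n : ℕ, W.HasSurjectiveModNGaloisRep ((2 ^ n : ℕ) : ℤ)) (h3 : Odd W.torsionOrder) (h4 : Odd W.tamagawaProduct)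
    (h5 : W.analyticRank = 1) (h6 : ShaTwoTrivial W) (h7 : ¬ (4 : ℕ) ∣ W.conductorNorm ℤ) (h8 : NontrivialAtTwo W)
    (hL : LevelRaisedAt W W' q) (hoo : W.Δ < 0 ∨ SameRealKummerLine W W') (hr : W'.analyticRank = 0)
    (P : (W.baseChange ℚ).toAffine.Point) (hP : NotTwiceRat W P) (hb : ¬ LocallyHalvable W q P) :
    selmerTwoCard W' = 1 ∧ ∃ n : ℕ, Odd n ∧ shaAn W' = (n : ℂ) :=
  ⟨((hA W W' q h1 h2 h3 h4 h5 h6 h7 h8 hL hoo P hP).1 hb).1,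
   (hC W W' q h1 h2 h3 h4 h5 h6 h7 h8 hL hoo hr P hP).2 hb⟩

end Summit.BirchSwinnertonDyer.BirchSwinnertonDyer.Theorems.RankOneAtTwoLevelRaising
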